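import Mathlib
import HarnessLib.Audit
import Summits.PneNP.PneNP.Theorems.PstarChordBridgeCorner
import Summits.PneNP.PneNP.Theorems.PstarChordBridgeCollapse

/-!
# The elliptic residue, combinatorially: bundles and (EXC) chords as complete-multipartite AND-graphs (ROUND-24, memo §4 / R7 (i′))

FRONTIER range-avoidance ladder, rung F-N3, ROUND 24 (cell `pnp-ideate`, planner memo `r24/CORE-BOUND-NOTES.md` §4 ("the extra members are the
`K_{2,2}` / `K_4` BUNDLES … dead by expansion"), §9 R4 / R7 (i′); restricted-model proof complexity — nothing here bears on `P` versus `NP`).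

After this generation's chain the residue of the `CoreShape` line on the algebra side is ONE object in three guises: (EXC) chords
(`Q_{D e} = q_m + ν₁ν₂ + κ`), non-killable BUNDLES (`Q_{D e'} = Q_{D e} + ν₁ν₂ + κ`, `PstarChordBridgeCollapse.Bundle`) and the (U2) factorisation
(`PstarChordBridgeCorner.corner_factorisation`).  This file turns the first two into COMBINATORICS of the core, ready for the expansion
accounting: the polar form of a product of affine functions is `ℓ₁ ⊗ ℓ₂ + ℓ₂ ⊗ ℓ₁` (`PstarRankRigidityTwo.affine_mul_polar`), and polar forms of
AND-sums are AND-adjacency indicators (`PstarPathRank.polar_basis`), so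

* `polar_symmDiff` — polar forms of output families add up to the polar form of the symmetric difference;
* `bundle_adj` — **a bundle is a complete multipartite AND-graph**: if `e, e'` form a bundle then for ALL variables `c, d`,
  `[c ~ d in D e ∆ D e'] = ℓ₁(e_c)ℓ₂(e_d) + ℓ₂(e_c)ℓ₁(e_d)` — the AND-graph of the (non-empty, `symmDiff_nonempty_of_ne`) family `D e ∆ D e' ⊆ J₀ ∖ N`
  is the complete tripartite graph on the level sets of `(ℓ₁, ℓ₂)`;
* `exc_adj` — **an (EXC) chord is a complete multipartite defect**: if `Q_{D e} = q_m + ν₁ν₂ + κ` then for every output `j` of the core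
  `[j ∈ D e] + ω(τ_j, m) = ℓ₁(e_{p_j})ℓ₂(e_{q_j}) + ℓ₂(e_{p_j})ℓ₁(e_{q_j})` (pendants off the core): the forest outputs on which the fundamental set
  and the join pattern of `q_m` disagree have AND pairs spanning a complete multipartite pattern.

What remains for (c) is the ACCOUNTING: a complete multipartite AND-graph inside a `3/2`-expanding core with simple overlaps has at most two
edges (a `σ`-pair), and `σ`-pairs are killable / not (EXC) — the memo's "bundles are expansion-dead".
-/

set_option linter.dupNamespace false -- `Summit.PneNP.PneNP.…`: summit = sub-problem name (D-0017 single-conjunct layout)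

open Finset Module Literature.Computability.Complexity
open scoped symmDiff
open Summit.PneNP.PneNP.Theorems.PstarTyped (Typed)
open Summit.PneNP.PneNP.Theorems.PstarSALevel (varSet bdry BoundaryExpanding SimpleOverlap)
open Summit.PneNP.PneNP.Theorems.PstarCubeIdeals (IsAffineFn)
open Summit.PneNP.PneNP.Theorems.PstarRankRigidityTwo (linPart symForm symForm_apply linPart_apply affine_mul_polar)
open Summit.PneNP.PneNP.Theorems.PstarProductRank (qform polar polar_apply)
open Summit.PneNP.PneNP.Theorems.PstarPathRank (AndAdj polar_basis)
open Summit.PneNP.PneNP.Theorems.PstarForcing (polar_unique)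
open Summit.PneNP.PneNP.Theorems.PstarGraphQuadGapTwoForms (sum_symmDiff_zmod2)
open Summit.PneNP.PneNP.Theorems.PstarReadSumset (V2)
open Summit.PneNP.PneNP.Theorems.PstarChordSystemMap (omega)
open Summit.PneNP.PneNP.Theorems.PstarChordBridgeTools
open Summit.PneNP.PneNP.Theorems.PstarChordBridge
open Summit.PneNP.PneNP.Theorems.PstarChordBridgeFundamental (eq_of_fundamental_eq)
open Summit.PneNP.PneNP.Theorems.PstarChordBridgeForcing
open Summit.PneNP.PneNP.Theorems.PstarChordBridgeCollapse (Bundle)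
open Summit.PneNP.PneNP.Theorems.PstarChordBridgeBasis
open Summit.PneNP.PneNP.Theorems.PstarChordBridgeCorner (andAdj_iff_mem qDir_add)

namespace Summit.PneNP.PneNP.Theorems.PstarChordBridgeBundle

variable {n m : ℕ}

/-- **Polar forms of output families add up to the polar form of the symmetric difference.** -/
theorem polar_symmDiff (I : LocalMap 4 n m) (A C : Finset (Fin m)) :
    polar (A ∆ C) (fun j => I.vars j 2) (fun j => I.vars j 3) =
      polar A (fun j => I.vars j 2) (fun j => I.vars j 3) + (polar C (fun j => I.vars j 2) (fun j => I.vars j 3) :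
        LinearMap.BilinForm (ZMod 2) (Fin n → ZMod 2)) := by
  classical
  refine LinearMap.ext₂ fun x w => ?_
  rw [LinearMap.add_apply, LinearMap.add_apply, polar_apply, polar_apply, polar_apply, sum_symmDiff_zmod2]

/-- Distinct chords have different fundamental sets (so a bundle's symmetric difference is non-empty). -/
theorem symmDiff_nonempty_of_ne (I : LocalMap 4 n m) (hI : I.IsPure xorAndPred) (hS : SimpleOverlap I) {B : BridgeData n m} (hW : B.WF I)
    {e e' : Fin m} (he : e ∈ B.N) (he' : e' ∈ B.N) (hne : e ≠ e') : (B.D e ∆ B.D e').Nonempty := by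
  rw [nonempty_iff_ne_empty, Ne, Finset.symmDiff_eq_empty]
  intro hDD
  have heD : e ∉ B.D e := fun h => (mem_sdiff.1 (hW.hD e he h)).2 he
  have heD' : e' ∉ B.D e := fun h => (mem_sdiff.1 (hW.hD e he h)).2 he'
  exact hne (eq_of_fundamental_eq I hI hS heD heD' (hW.hDeven e he) (hDD ▸ hW.hDeven e' he'))

/-- **A bundle is a complete multipartite AND-graph.**  If the chords `e, e'` form an elliptic bundle (`Q_{D e'} = Q_{D e} + ν₁ν₂ + κ`), then with
`ℓᵢ` the linear parts of `νᵢ`: `c, d` are AND-adjacent in `D e ∆ D e'` iff `ℓ₁(e_c)ℓ₂(e_d) + ℓ₂(e_c)ℓ₁(e_d) = 1`. -/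
theorem bundle_adj (I : LocalMap 4 n m) (hI : I.IsPure xorAndPred) (hS : SimpleOverlap I) (B : BridgeData n m) {e e' : Fin m}
    {ν₁ ν₂ : (Fin n → ZMod 2) → ZMod 2} (h₁ : IsAffineFn ν₁) (h₂ : IsAffineFn ν₂) {κ : ZMod 2}
    (hb : ∀ x, qform (B.D e') (fun j => I.vars j 2) (fun j => I.vars j 3) x =
      qform (B.D e) (fun j => I.vars j 2) (fun j => I.vars j 3) x + ν₁ x * ν₂ x + κ) (c d : Fin n) :
    (if AndAdj I (B.D e ∆ B.D e') c d then (1 : ZMod 2) else 0) =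
      linPart h₁ (Pi.single c 1) * linPart h₂ (Pi.single d 1) + linPart h₁ (Pi.single d 1) * linPart h₂ (Pi.single c 1) := by
  classical
  -- polar form of `Q_{D e'}` two ways
  have hpol : polar (B.D e') (fun j => I.vars j 2) (fun j => I.vars j 3) =
      polar (B.D e) (fun j => I.vars j 2) (fun j => I.vars j 3) + symForm (linPart h₁) (linPart h₂) := by
    refine polar_unique (Q := qform (B.D e') (fun j => I.vars j 2) (fun j => I.vars j 3)) (qform_add' I (B.D e')) fun x w => ?_
    rw [hb, hb, hb, hb, qform_add' I (B.D e) x w, LinearMap.add_apply, LinearMap.add_apply, affine_mul_polar h₁ h₂ x w]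
    have hk : κ + κ = 0 := by generalize κ = t; revert t; decide
    linear_combination (-1 : ZMod 2) * hk
  have hΔ : polar (B.D e ∆ B.D e') (fun j => I.vars j 2) (fun j => I.vars j 3) = symForm (linPart h₁) (linPart h₂) := by
    rw [polar_symmDiff, hpol, ← add_assoc]
    have h2 : polar (B.D e) (fun j => I.vars j 2) (fun j => I.vars j 3) + polar (B.D e) (fun j => I.vars j 2) (fun j => I.vars j 3) =
        (0 : LinearMap.BilinForm (ZMod 2) (Fin n → ZMod 2)) := by
      refine LinearMap.ext₂ fun x w => ?_
      rw [LinearMap.add_apply, LinearMap.add_apply, LinearMap.zero_apply, LinearMap.zero_apply]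
      generalize polar (B.D e) (fun j => I.vars j 2) (fun j => I.vars j 3) x w = t; revert t; decide
    rw [h2, zero_add]
  have h := congrArg (fun P : LinearMap.BilinForm (ZMod 2) (Fin n → ZMod 2) => P (Pi.single c 1) (Pi.single d 1)) hΔ
  simp only [polar_basis I hI hS, symForm_apply] at h
  exact h

/-- **An (EXC) chord is a complete multipartite defect.**  If `Q_{D e} = q_m + ν₁ν₂ + κ` then for every output `j` of the core (pendants off the
core) `[j ∈ D e] + ω(τ_j, m) = ℓ₁(e_{p_j})ℓ₂(e_{q_j}) + ℓ₂(e_{p_j})ℓ₁(e_{q_j})`. -/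
theorem exc_adj (I : LocalMap 4 n m) (hI : I.IsPure xorAndPred) (hS : SimpleOverlap I) (B : BridgeData n m) (hG₁ : Disjoint B.J₀ B.G₁)
    (hG₂ : Disjoint B.J₀ B.G₂) {mv : V2} {e : Fin m} {ν₁ ν₂ : (Fin n → ZMod 2) → ZMod 2} (h₁ : IsAffineFn ν₁) (h₂ : IsAffineFn ν₂) {κ : ZMod 2}
    (hx : ∀ x, qform (B.D e) (fun j => I.vars j 2) (fun j => I.vars j 3) x = qDir I B mv x + ν₁ x * ν₂ x + κ) {j : Fin m} (hj : j ∈ B.J₀) :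
    (if j ∈ B.D e then (1 : ZMod 2) else 0) + omega ((if j ∈ B.T₁ then 1 else 0), (if j ∈ B.T₂ then 1 else 0)) mv =
      linPart h₁ (Pi.single (I.vars j 2) 1) * linPart h₂ (Pi.single (I.vars j 3) 1) +
        linPart h₁ (Pi.single (I.vars j 3) 1) * linPart h₂ (Pi.single (I.vars j 2) 1) := by
  classical
  have hpol : polar (B.D e) (fun j => I.vars j 2) (fun j => I.vars j 3) = polarDir I B mv + symForm (linPart h₁) (linPart h₂) := by
    refine polar_unique (Q := qform (B.D e) (fun j => I.vars j 2) (fun j => I.vars j 3)) (qform_add' I (B.D e)) fun x w => ?_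
    rw [hx, hx, hx, hx, qDir_add I B mv x w, LinearMap.add_apply, LinearMap.add_apply, affine_mul_polar h₁ h₂ x w]
    have hk : κ + κ = 0 := by generalize κ = t; revert t; decide
    linear_combination (-1 : ZMod 2) * hk
  have h := congrArg (fun P : LinearMap.BilinForm (ZMod 2) (Fin n → ZMod 2) => P (Pi.single (I.vars j 2) 1) (Pi.single (I.vars j 3) 1)) hpol
  simp only [LinearMap.add_apply, polar_basis I hI hS, andAdj_iff_mem I hI hS, symForm_apply] at h
  -- the `polarDir` entry at a core output is its join pattern
  have hjG₁ : j ∉ freeMon I B.N B.G₁ := fun h' => disjoint_left.1 hG₁ hj (mem_filter.1 h').1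
  have hjG₂ : j ∉ freeMon I B.N B.G₂ := fun h' => disjoint_left.1 hG₂ hj (mem_filter.1 h').1
  have hdir : polarDir I B mv (Pi.single (I.vars j 2) 1) (Pi.single (I.vars j 3) 1) =
      omega ((if j ∈ B.T₁ then 1 else 0), (if j ∈ B.T₂ then 1 else 0)) mv := by
    simp only [polarDir, freePolar, LinearMap.add_apply, LinearMap.smul_apply, smul_eq_mul, polar_basis I hI hS, andAdj_iff_mem I hI hS,
      if_neg hjG₁, if_neg hjG₂, add_zero]
    unfold omega
    ring
  rw [hdir] at h
  rw [h]
  have hoo : omega ((if j ∈ B.T₁ then 1 else 0), (if j ∈ B.T₂ then 1 else 0)) mv + omega ((if j ∈ B.T₁ then 1 else 0), (if j ∈ B.T₂ then 1 else 0)) mv = 0 := by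
    generalize omega ((if j ∈ B.T₁ then 1 else 0), (if j ∈ B.T₂ then 1 else 0)) mv = t; revert t; decide
  linear_combination hoo

end Summit.PneNP.PneNP.Theorems.PstarChordBridgeBundle
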